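import Summits.BirchSwinnertonDyer.BirchSwinnertonDyer.Theorems.SylvesterTwoHeegnerIndexCMHalfPrep
import Literature.NumberTheory.EllipticCurves.HuShuYin2019.SylvesterTowerFrobeniusAtThree
import Literature.NumberTheory.EllipticCurves.HuShuYin2019.SylvesterTowerRamifiedLayerDegree
import Literature.NumberTheory.EllipticCurves.RingClassFieldInertia
import Literature.NumberTheory.EllipticCurves.HeegnerPointsKolyvaginLocalCriterion
import Literature.NumberTheory.EllipticCurves.HasseWeilAbelianEulerFactorEllipticSplitProofs
import HarnessLib

/-!
# (S10a) of leaf (L1) at `p ≡ 7 (mod 9)`, crux `UpperOffV0HSYPlus` (stmt-BirchSwinnertonDyer-19804): THE DECOMPOSITION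
# GROUP AT `w ∣ 3` IN THE SYLVESTER TOWER `K[9pn]/K` HAS ORDER DIVIDING `18` — the CFT half of the LOCAL tower fixing

Skeleton VARIANT M 406ca288e244d392, stub `stub_layerL1Seven`; planner D531 (3) (successor task #S10: «the LOCAL clause
of hTF is REDUCIBLE to "φ_n ∈ D_𝔚(K[9pn]/K)" (D_𝔚 abelian of order 18 ⇒ a unique involution; Φ_n := preimage of ⟨φ_n⟩ in
Γ_{K_v} has odd index 9) — a WRAPPER deriving hTF-LOCAL from #21a/#21b»).  #S9c's displayed tower fixing `hTF`
(p685405 l.60–85) asks, at each Kolyvagin level `n` and each `v ∣ 3` of `K`, for an OPEN subgroup `Φ ≤ Γ_{K_v}` of ODD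
index acting on the embedded `K[9pn] ⊂ K̄` through `{1, φ_n}`.  This file supplies the class-field-theoretic content of
that clause as TREE THEOREMS, so that the sequel (#S10b) can replace it by «`φ_n` is an involution lying in the
decomposition group»:

* §1 `exists_restrictHom` — the restriction `r : Γ_K →* Gal(K[m]/K)` along a `K`-embedding `emb : K[m] → K̄`
  (`g ∘ emb = emb ∘ r g`), surjective with open kernel (Mathlib `AlgEquiv.restrictNormalHom` on the field range +
  `AlgEquiv.autCongr`; as in k-ty1 #21a's proof).
* §2 **`exists_decompositionBound_three`** — for `K ∋ ω` quadratic, `p ≡ 1 (3)` prime, `3 ∤ n`, `v ∋ 3`, any `K`-embedding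
  `e : K[9pn] → K̄` and any such `r`: there is a subgroup `P ≤ Gal(K[9pn]/K)` with **`#P ∣ 18`** containing `r(res τ)` for
  EVERY `τ ∈ Γ_{K_v}` (`res = resGal : Γ_{K_v} → Γ_K`).  Proof: `res τ` lies in the decomposition group `D_𝔓` of the prime
  `𝔓` of `\bar ℤ_K` cut out by `K̄ → K̄_v` (tree `resGalOfEmb_mem_decompositionSubgroup`); `D_𝔓` is contained in every
  closed submonoid containing the inertia group `I_𝔓` and one Frobenius (tree
  `decompositionSubgroup_subset_of_isClosed_of_frobenius_mem`); `I_𝔓` acts trivially on `K[pn]` (`3 ∤ pn`: tree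
  `isUnramifiedIn_ringClassField` + `mem_of_mem_inertia_of_isUnramifiedIn`) and a Frobenius acts on `K[pn]` by an
  involution (k-ty1 #21a `JZero.exists_involution_apply_emb_eq_of_isArithFrobAt_three`); so with
  `ρ : Gal(K[9pn]/K) → Gal(K[pn]/K)` the restriction (`MonoidHom.liftOfSurjective`), `P := ρ⁻¹⟨ρ(r F)⟩` works, and
  `#P = #ker ρ · #(P.map ρ)` with `#ker ρ = [K[9pn]:K]/[K[pn]:K] = 9` (k-ty1 #21b `JZero.finrank_ringClassField_nine_mul`)
  and `#(P.map ρ) ∣ 2`.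
* §3 **`exists_oddIndex_localFixer`** — hence, for an INVOLUTION `φ ≠ 1` of `K[9pn]/K` realised by some `τ₀ ∈ Γ_{K_v}`
  (`res τ₀ ∘ e = e ∘ φ`), the subgroup `Φ := (r ∘ res)⁻¹⟨φ⟩ ≤ Γ_{K_v}` is OPEN, has ODD index (`= #D′/2 ∣ 9`, `D′` the image of
  `Γ_{K_v}`), and acts on `e(K[9pn])` through `{1, φ}` — EXACTLY the local datum displayed in #S9c's `hTF`.

HONEST LABEL: theorems only (no `def`, no `sorry`, no new `Prop`); pure CFT of the tower, nothing about points or `Ш`;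
nothing asserted on 19804; no stub closed; X12.CMAtTwo NOT proved; BSD is not proved by any of this, for any curve.
`--supports stmt-BirchSwinnertonDyer-19804 --as helper`.
-/

set_option linter.dupNamespace false
set_option autoImplicit false

noncomputable section

open scoped Classical Pointwise

namespace Summit.BirchSwinnertonDyer.BirchSwinnertonDyer.Theorems.SylvesterTwoCMHalf

open Field NumberField IsDedekindDomain IsDedekindDomain.HeightOneSpectrum Module
open Literature.NumberTheory.EllipticCurves Literature.NumberTheory.GaloisRepresentations
  Literature.NumberTheory.EllipticCurves.HuShuYin2019
  Literature.NumberTheory.EllipticCurves.RingClassField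
  Summit.BirchSwinnertonDyer.Rank1Residual.X11b Summit.BirchSwinnertonDyer.Rank1Residual.X11b.RingClassTower

variable {K : Type} [Field K] [NumberField K]

/-! ## §1 The restriction `Γ_K → Gal(K[m]/K)` along an embedding -/

/-- **The restriction homomorphism along a `K`-embedding `emb : K[m] → K̄`**: a group homomorphism
`r : Γ_K → Gal(K[m]/K)` with `g ∘ emb = emb ∘ r(g)`, surjective, with open kernel (`= Gal(K̄/emb K[m])`).
[cite: NeukirchANT1999, Ch. IV §1 Thm. (1.1)] [cite: GrossLMS1991, §3 (𝒢_n = Gal(K_n/K))] -/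
theorem exists_restrictHom (hK : IsImaginaryQuadratic K) (ι : K →+* ℂ) {m : ℕ} (hm0 : m ≠ 0)
    (emb : ringClassField K ι m →+* AlgebraicClosure K)
    (hemb : ∀ k : K, emb (algebraMap K (ringClassField K ι m) k) = algebraMap K (AlgebraicClosure K) k) :
    ∃ r : absoluteGaloisGroup K →* (ringClassField K ι m ≃ₐ[K] ringClassField K ι m),
      (∀ (g : absoluteGaloisGroup K) (x : ringClassField K ι m),
        (show AlgebraicClosure K ≃ₐ[K] AlgebraicClosure K from g) (emb x) = emb (r g x)) ∧
      Function.Surjective r ∧ IsOpen (r.ker : Set (absoluteGaloisGroup K)) := by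
  haveI := (finiteDimensional_and_isGalois_ringClassField hK ι hm0).1
  haveI := (finiteDimensional_and_isGalois_ringClassField hK ι hm0).2
  set φ : ringClassField K ι m →ₐ[K] AlgebraicClosure K := AlgHom.mk emb hemb with hφ
  let e : ringClassField K ι m ≃ₐ[K] φ.fieldRange := AlgEquiv.ofInjectiveField φ
  have he : ∀ x, ((e x : φ.fieldRange) : AlgebraicClosure K) = emb x := fun x ↦
    AlgEquiv.ofInjective_apply φ φ.toRingHom.injective x
  haveI : Normal K φ.fieldRange := Normal.of_algEquiv e
  let r : absoluteGaloisGroup K →* (ringClassField K ι m ≃ₐ[K] ringClassField K ι m) :=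
    (AlgEquiv.autCongr e).symm.toMonoidHom.comp (absRestrictNormalHom φ.fieldRange)
  have hr : ∀ g x, r g x = e.symm (absRestrictNormalHom φ.fieldRange g (e x)) := fun _ _ ↦ rfl
  have hres : ∀ (g : absoluteGaloisGroup K) (y : φ.fieldRange),
      ((absRestrictNormalHom φ.fieldRange g y : φ.fieldRange) : AlgebraicClosure K) =
        (show AlgebraicClosure K ≃ₐ[K] AlgebraicClosure K from g) y :=
    fun g y ↦ AlgEquiv.restrictNormalHom_apply _ _ y
  haveI : FiniteDimensional K φ.fieldRange := LinearEquiv.finiteDimensional e.toLinearEquiv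
  refine ⟨r, fun g x ↦ ?_, fun σ ↦ ?_, ?_⟩
  · rw [hr, ← he (e.symm (absRestrictNormalHom φ.fieldRange g (e x))), AlgEquiv.apply_symm_apply, hres, he]
  · obtain ⟨g, hg⟩ := AlgEquiv.restrictNormalHom_surjective (F := K) (K₁ := φ.fieldRange)
      (E := AlgebraicClosure K) (AlgEquiv.autCongr e σ)
    refine ⟨(absoluteGaloisGroup.toAlgEquiv K).symm g, ?_⟩
    change (AlgEquiv.autCongr e).symm (AlgEquiv.restrictNormalHom φ.fieldRange g) = σ
    rw [hg, MulEquiv.symm_apply_apply]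
  · refine Subgroup.isOpen_mono (H₁ := (φ.fieldRange.fixingSubgroup : Subgroup (absoluteGaloisGroup K))) ?_
      φ.fieldRange.fixingSubgroup_isOpen
    intro g hg
    show r g = 1
    refine AlgEquiv.ext fun x ↦ ?_
    rw [hr, AlgEquiv.one_apply, AlgEquiv.symm_apply_eq]
    apply Subtype.ext
    rw [hres]
    exact (IntermediateField.mem_fixingSubgroup_iff _ _).mp hg _ (e x).2

/-! ## §2 The decomposition group at `w ∣ 3` in `K[9pn]/K` has order dividing `18` -/

set_option maxHeartbeats 1600000 in
/-- **`#D_w(K[9pn]/K) ∣ 18` in the form the rows use.**  `K ∋ ω` quadratic (`K = ℚ(√−3)`), `p ≡ 1 (mod 3)` prime,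
`n ≠ 0` with `3 ∤ n`, `v` the place of `K` above `3`, `e : K[9pn] → K̄` a `K`-embedding and `r : Γ_K → Gal(K[9pn]/K)`
the restriction along `e`.  Then the image of `Γ_{K_v} → Γ_K → Gal(K[9pn]/K)` lies in a subgroup `P` with `#P ∣ 18`:
the decomposition group is generated (topologically) by inertia — trivial on `K[pn]` (`w ∤ pn`), so of image inside
`Gal(K[9pn]/K[pn])` of order `9` — and a Frobenius, whose image on `K[pn]` is the involution `(w, K[pn]/K)` (`f_w = 2`).
[cite: NeukirchANT1999, Ch. I §9 Prop. (9.4)–(9.6), Ch. II §9 Prop. (9.6)] [cite: Cox2013, §9.A (9.1), Cor. 5.21]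
[cite: HuShuYin2019, §2.2 Prop. 2.4 (1) (PDF pp. 6–7)] -/
theorem exists_decompositionBound_three {ω : K} (hω : ω ^ 2 + ω + 1 = 0) (h2 : finrank ℚ K = 2)
    (ι : K →+* ℂ) {p n : ℕ} (hp : p.Prime) (hp3 : p % 3 = 1) (hn0 : n ≠ 0) (hn3 : ¬ 3 ∣ n)
    (v : HeightOneSpectrum (𝓞 K)) (hv : ((3 : ℕ) : 𝓞 K) ∈ v.asIdeal)
    (e : ringClassField K ι (9 * p * n) →+* AlgebraicClosure K)
    (he : ∀ k : K, e (algebraMap K (ringClassField K ι (9 * p * n)) k) = algebraMap K (AlgebraicClosure K) k)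
    (r : absoluteGaloisGroup K →* (ringClassField K ι (9 * p * n) ≃ₐ[K] ringClassField K ι (9 * p * n)))
    (hr : ∀ (g : absoluteGaloisGroup K) (x : ringClassField K ι (9 * p * n)),
      (show AlgebraicClosure K ≃ₐ[K] AlgebraicClosure K from g) (e x) = e (r g x))
    (hrsurj : Function.Surjective r) :
    ∃ P : Subgroup (ringClassField K ι (9 * p * n) ≃ₐ[K] ringClassField K ι (9 * p * n)),
      Nat.card P ∣ 18 ∧
      ∀ τ : absoluteGaloisGroup (v.adicCompletion K), r (resGal (K := K) (v.adicCompletion K) τ) ∈ P := by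
  have hK := JZero.isImaginaryQuadratic_of_sq_add_self_add_one hω h2
  -- ### the conductor `m = pn`: `3 ∤ m`, `p ∣ m`, `2 ≤ m`, `9m = 9pn`
  have hp0 : p ≠ 0 := hp.ne_zero
  have hm0 : p * n ≠ 0 := mul_ne_zero hp0 hn0
  have hm3 : ¬ 3 ∣ p * n := by
    intro h
    rcases (Nat.Prime.dvd_mul Nat.prime_three).mp h with h3 | h3
    · have := Nat.mod_eq_zero_of_dvd h3
      omega
    · exact hn3 h3
  have hm2 : 2 ≤ p * n := by
    have := hp.two_le
    have : 1 ≤ n := Nat.one_le_iff_ne_zero.mpr hn0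
    nlinarith
  have h9m : 9 * p * n = 9 * (p * n) := by ring
  have h9m0 : 9 * p * n ≠ 0 := by rw [h9m]; exact mul_ne_zero (by norm_num) hm0
  haveI := (finiteDimensional_and_isGalois_ringClassField hK ι h9m0).1
  haveI := (finiteDimensional_and_isGalois_ringClassField hK ι h9m0).2
  haveI := (finiteDimensional_and_isGalois_ringClassField hK ι hm0).1
  haveI := (finiteDimensional_and_isGalois_ringClassField hK ι hm0).2
  -- ### the sub-level `K[pn] ≤ K[9pn]` and its embedding `e' = e ∘ incl`
  have hle : ringClassField K ι (p * n) ≤ ringClassField K ι (9 * p * n) :=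
    ringClassField_mono hK ι (Dvd.intro_left 9 h9m.symm) h9m0
  set e' : ringClassField K ι (p * n) →+* AlgebraicClosure K := e.comp (RingClassField.inclusion ι hle) with he'def
  have he' : ∀ k : K, e' (algebraMap K (ringClassField K ι (p * n)) k) = algebraMap K (AlgebraicClosure K) k := by
    intro k
    show e (RingClassField.inclusion ι hle (algebraMap K (ringClassField K ι (p * n)) k)) = _
    rw [(RingClassField.inclusion ι hle).commutes, he]
  have hcoh : ∀ x, e' x = e (RingClassField.inclusion ι hle x) := fun _ ↦ rfl
  obtain ⟨r₁, hr₁, hr₁surj, hr₁ker⟩ := exists_restrictHom hK ι hm0 e' he'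
  -- `ker r ≤ ker r₁`: fixing `e(K[9pn])` fixes `e'(K[pn])`
  have hker : r.ker ≤ r₁.ker := by
    intro g hg
    rw [MonoidHom.mem_ker] at hg ⊢
    refine AlgEquiv.ext fun y ↦ e'.injective ?_
    rw [← hr₁, AlgEquiv.one_apply, hcoh, hr, hg, AlgEquiv.one_apply]
  -- ### the restriction `ρ : Gal(K[9pn]/K) → Gal(K[pn]/K)`, `ρ ∘ r = r₁`
  set ρ := r.liftOfSurjective hrsurj ⟨r₁, hker⟩ with hρdef
  have hρ : ∀ g, ρ (r g) = r₁ g := fun g ↦ r.liftOfRightInverse_comp_apply _ _ ⟨r₁, hker⟩ g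
  have hρsurj : Function.Surjective ρ := fun σ ↦ by
    obtain ⟨g, rfl⟩ := hr₁surj σ
    exact ⟨r g, hρ g⟩
  -- `#ker ρ = 9`
  have hcard9 : Nat.card (ringClassField K ι (9 * p * n) ≃ₐ[K] ringClassField K ι (9 * p * n)) =
      9 * Nat.card (ringClassField K ι (p * n) ≃ₐ[K] ringClassField K ι (p * n)) := by
    rw [IsGalois.card_aut_eq_finrank, IsGalois.card_aut_eq_finrank]
    have h := JZero.finrank_ringClassField_nine_mul hω h2 ι hm3 hm2
    rw [← h9m] at h
    exact h
  have hkerρ : Nat.card ρ.ker = 9 := by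
    have h1 := Subgroup.card_mul_index ρ.ker
    rw [Subgroup.index_ker, MonoidHom.range_eq_top.mpr hρsurj, Subgroup.card_top, hcard9] at h1
    have hpos : 0 < Nat.card (ringClassField K ι (p * n) ≃ₐ[K] ringClassField K ι (p * n)) := Nat.card_pos
    exact Nat.eq_of_mul_eq_mul_right hpos h1
  -- ### the prime `𝔓` of `\bar ℤ_K` cut out by `K̄ → K̄_v`, a Frobenius `F` at `𝔓`, and its involution on `K[pn]`
  obtain ⟨𝔐, h𝔐⟩ := v.localPrimesAbove_nonempty
  have h𝔓 := v.primeBelow_mem_primesAbove (ι := closureEmb (K := K) (v.adicCompletion K)) h𝔐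
  obtain ⟨F, hF⟩ := HeightOneSpectrum.exists_isArithFrobAt_of_mem_primesAbove_holds (v := v) h𝔓
  obtain ⟨σ₀, -, -, hσ₀2, hσ₀F⟩ := JZero.exists_involution_apply_emb_eq_of_isArithFrobAt_three hω h2 ι v hv hm3 hp
    hp3 (Dvd.intro n rfl) e' he' h𝔓 hF
  have hF2 : r₁ F * r₁ F = 1 := by
    have h1 : ∀ y, r₁ F y = σ₀ y := fun y ↦ e'.injective (by rw [← hr₁]; exact hσ₀F y)
    refine AlgEquiv.ext fun y ↦ ?_
    rw [AlgEquiv.mul_apply, h1, h1, ← AlgEquiv.mul_apply, hσ₀2]; rfl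
  -- ### `P := ρ⁻¹ ⟨r₁ F⟩`
  refine ⟨(Subgroup.zpowers (r₁ F)).comap ρ, ?_, fun τ ↦ ?_⟩
  · -- `#P = #ker ρ · #(P.map ρ)`, `#(P.map ρ) ∣ #⟨r₁ F⟩ ∣ 2`
    set P := (Subgroup.zpowers (r₁ F)).comap ρ with hPdef
    have hkerle : ρ.ker ≤ P := fun x hx ↦ by
      rw [hPdef, Subgroup.mem_comap, MonoidHom.mem_ker.mp hx]; exact Subgroup.one_mem _
    have hmul : Nat.card ρ.ker * ρ.ker.relIndex P = Nat.card P := by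
      rw [← Subgroup.relIndex_bot_left, ← Subgroup.relIndex_bot_left]
      exact Subgroup.relIndex_mul_relIndex ⊥ ρ.ker P bot_le hkerle
    have hmap : ρ.ker.relIndex P ∣ 2 := by
      rw [Subgroup.relIndex_ker]
      have hle2 : P.map ρ ≤ Subgroup.zpowers (r₁ F) := Subgroup.map_comap_le _ _
      refine (Subgroup.card_dvd_of_le hle2).trans ?_
      rw [Nat.card_zpowers]
      exact orderOf_dvd_of_pow_eq_one (by rw [pow_two]; exact hF2)
    rw [← hmul, hkerρ, show (18 : ℕ) = 9 * 2 from rfl]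
    exact mul_dvd_mul_left 9 hmap
  · -- `res τ ∈ D_𝔓 ⊆ S := r⁻¹ P` (closed submonoid containing `I_𝔓` and `F`)
    set S : Subgroup (absoluteGaloisGroup K) := ((Subgroup.zpowers (r₁ F)).comap ρ).comap r with hSdef
    have hSmem : ∀ g : absoluteGaloisGroup K, g ∈ S ↔ r₁ g ∈ Subgroup.zpowers (r₁ F) := fun g ↦ by
      rw [hSdef, Subgroup.mem_comap, Subgroup.mem_comap, hρ]
    have hkerS : r₁.ker ≤ S := fun g hg ↦ by
      rw [hSmem, MonoidHom.mem_ker.mp hg]; exact Subgroup.one_mem _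
    -- `S` is open (it contains `ker r₁`, open), hence closed
    have hSopen : IsOpen (S : Set (absoluteGaloisGroup K)) := Subgroup.isOpen_mono hkerS hr₁ker
    have hSclosed : IsClosed (S : Set (absoluteGaloisGroup K)) := Subgroup.isClosed_of_isOpen S hSopen
    -- inertia: `K[pn]/K` is unramified at `v` (`3 ∤ pn`), so `I_𝔓` fixes `e'(K[pn])`, i.e. `r₁ i = 1`
    obtain ⟨N₁, hN₁⟩ := exists_subgroup_mem_iff e' he'
    have hunr : Algebra.IsUnramifiedIn (𝓞 (ringClassField K ι (p * n))) v.asIdeal :=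
      isUnramifiedIn_ringClassField hK ι hm0 (JZero.not_span_natCast_le_of_not_three_dvd v hv hm3)
    have hI : ∀ i ∈ (v.primeBelow (closureEmb (K := K) (v.adicCompletion K)) 𝔐).inertia (absoluteGaloisGroup K),
        i ∈ (S : Set (absoluteGaloisGroup K)) := by
      intro i hi
      have hiN : i ∈ N₁ := mem_of_mem_inertia_of_isUnramifiedIn e' he' N₁ hN₁ v hunr h𝔓 hi
      have hi1 : r₁ i = 1 := by
        refine AlgEquiv.ext fun y ↦ e'.injective ?_
        rw [← hr₁, AlgEquiv.one_apply]
        exact (hN₁ i).mp hiN y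
      show i ∈ S
      rw [hSmem, hi1]; exact Subgroup.one_mem _
    have hFS : F ∈ (S : Set (absoluteGaloisGroup K)) := by
      show F ∈ S
      rw [hSmem]; exact Subgroup.mem_zpowers _
    have hDS := decompositionSubgroup_subset_of_isClosed_of_frobenius_mem h𝔓 hF hSclosed S.one_mem
      (fun g hg g' hg' ↦ S.mul_mem hg hg') hI hFS
    have hτD : resGal (K := K) (v.adicCompletion K) τ ∈
        (v.primeBelow (closureEmb (K := K) (v.adicCompletion K)) 𝔐).decompositionSubgroup (absoluteGaloisGroup K) :=
      resGalOfEmb_mem_decompositionSubgroup (closureEmb (K := K) (v.adicCompletion K)) h𝔐 τ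
    have hτS : resGal (K := K) (v.adicCompletion K) τ ∈ S := hDS hτD
    rw [hSdef, Subgroup.mem_comap] at hτS
    exact hτS

/-! ## §3 The odd-index open subgroup `Φ ≤ Γ_{K_v}` acting through `{1, φ}` -/

set_option maxHeartbeats 800000 in
/-- **THE LOCAL TOWER-FIXING DATUM FROM «`φ` is an involution in the decomposition group».**  Same tower; let
`φ ≠ 1` be an involution of `K[9pn]/K` and `τ₀ ∈ Γ_{K_v}` (`v ∋ 3`) with `res τ₀ ∘ e = e ∘ φ`.  Then there is an OPEN
subgroup `Φ ≤ Γ_{K_v}` of index COPRIME TO `2` every element of which acts on `e(K[9pn])` either trivially or as `φ` —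
namely `Φ = (r ∘ res)⁻¹⟨φ⟩`, of index `#D′/2 ∣ 9` (`D′ ∋ φ` the image of `Γ_{K_v}`, `#D′ ∣ 18` by §2).  This is the
`∃ Φ`-clause of #S9c's displayed `hTF`, verbatim. [cite: NeukirchANT1999, Ch. II §9 Prop. (9.6)]
[cite: GrossLMS1991, §3] [cite: HuShuYin2019, §2.2 Prop. 2.4 (1)] -/
theorem exists_oddIndex_localFixer {ω : K} (hω : ω ^ 2 + ω + 1 = 0) (h2 : finrank ℚ K = 2)
    (ι : K →+* ℂ) {p n : ℕ} (hp : p.Prime) (hp3 : p % 3 = 1) (hn0 : n ≠ 0) (hn3 : ¬ 3 ∣ n)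
    (v : HeightOneSpectrum (𝓞 K)) (hv : ((3 : ℕ) : 𝓞 K) ∈ v.asIdeal)
    (e : ringClassField K ι (9 * p * n) →+* AlgebraicClosure K)
    (he : ∀ k : K, e (algebraMap K (ringClassField K ι (9 * p * n)) k) = algebraMap K (AlgebraicClosure K) k)
    {φ : ringClassField K ι (9 * p * n) ≃ₐ[K] ringClassField K ι (9 * p * n)} (hφ1 : φ ≠ 1) (hφ2 : φ * φ = 1)
    {τ₀ : absoluteGaloisGroup (v.adicCompletion K)}
    (hτ₀ : ∀ x : ringClassField K ι (9 * p * n), (show AlgebraicClosure K ≃ₐ[K] AlgebraicClosure K from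
      resGal (K := K) (v.adicCompletion K) τ₀) (e x) = e (φ x)) :
    ∃ Φ : Subgroup (absoluteGaloisGroup (v.adicCompletion K)),
      IsOpen (Φ : Set (absoluteGaloisGroup (v.adicCompletion K))) ∧ IsCoprime (Φ.index : ℤ) ((2 : ℕ) : ℤ) ∧
      ∀ τ ∈ Φ, (∀ x : ringClassField K ι (9 * p * n), (show AlgebraicClosure K ≃ₐ[K] AlgebraicClosure K from
          resGal (K := K) (v.adicCompletion K) τ) (e x) = e x) ∨
        (∀ x : ringClassField K ι (9 * p * n), (show AlgebraicClosure K ≃ₐ[K] AlgebraicClosure K from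
          resGal (K := K) (v.adicCompletion K) τ) (e x) = e (φ x)) := by
  have hK := JZero.isImaginaryQuadratic_of_sq_add_self_add_one hω h2
  have h9m0 : 9 * p * n ≠ 0 := mul_ne_zero (mul_ne_zero (by norm_num) hp.ne_zero) hn0
  haveI := (finiteDimensional_and_isGalois_ringClassField hK ι h9m0).1
  haveI := (finiteDimensional_and_isGalois_ringClassField hK ι h9m0).2
  obtain ⟨r, hr, hrsurj, hrker⟩ := exists_restrictHom hK ι h9m0 e he
  obtain ⟨P, hP18, hPmem⟩ := exists_decompositionBound_three hω h2 ι hp hp3 hn0 hn3 v hv e he r hr hrsurj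
  set r' : absoluteGaloisGroup (v.adicCompletion K) →*
      (ringClassField K ι (9 * p * n) ≃ₐ[K] ringClassField K ι (9 * p * n)) :=
    r.comp (resGal (K := K) (v.adicCompletion K)).toMonoidHom with hr'def
  have hr' : ∀ τ x, (show AlgebraicClosure K ≃ₐ[K] AlgebraicClosure K from resGal (K := K) (v.adicCompletion K) τ)
      (e x) = e (r' τ x) := fun τ x ↦ hr _ x
  have hφ : r' τ₀ = φ := AlgEquiv.ext fun x ↦ e.injective (by rw [← hr', hτ₀])
  set Φ := (Subgroup.zpowers φ).comap r' with hΦdef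
  have hΦmem : ∀ τ, τ ∈ Φ ↔ r' τ ∈ Subgroup.zpowers φ := fun τ ↦ by rw [hΦdef, Subgroup.mem_comap]
  refine ⟨Φ, ?_, ?_, fun τ hτ ↦ ?_⟩
  · -- open: `Φ ⊇ ker r' = res⁻¹(ker r)`, open by continuity of `res`
    have hk : IsOpen (r'.ker : Set (absoluteGaloisGroup (v.adicCompletion K))) := by
      have : (r'.ker : Set (absoluteGaloisGroup (v.adicCompletion K))) =
          (resGal (K := K) (v.adicCompletion K)) ⁻¹' (r.ker : Set (absoluteGaloisGroup K)) := by
        ext τ; simp only [SetLike.mem_coe, MonoidHom.mem_ker, Set.mem_preimage, hr'def, MonoidHom.comp_apply]; rfl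
      rw [this]
      exact hrker.preimage (resGal (K := K) (v.adicCompletion K)).continuous
    refine Subgroup.isOpen_mono (fun τ hτ ↦ ?_) hk
    rw [hΦmem, MonoidHom.mem_ker.mp hτ]; exact Subgroup.one_mem _
  · -- index: `#⟨φ⟩ · [D′ : ⟨φ⟩] = #D′ ∣ #P ∣ 18`, `#⟨φ⟩ = 2`
    haveI : Fact (Nat.Prime 2) := ⟨Nat.prime_two⟩
    have hord : orderOf φ = 2 := orderOf_eq_prime (by rw [pow_two]; exact hφ2) hφ1
    have hle : Subgroup.zpowers φ ≤ r'.range := by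
      rw [Subgroup.zpowers_le, ← hφ]; exact ⟨τ₀, rfl⟩
    have hDle : r'.range ≤ P := by
      rintro _ ⟨τ, rfl⟩; exact hPmem τ
    have hidx : Φ.index = (Subgroup.zpowers φ).relIndex r'.range := Subgroup.index_comap _ _
    have hmul : Nat.card (Subgroup.zpowers φ) * (Subgroup.zpowers φ).relIndex r'.range = Nat.card r'.range := by
      rw [← Subgroup.relIndex_bot_left, ← Subgroup.relIndex_bot_left]
      exact Subgroup.relIndex_mul_relIndex ⊥ (Subgroup.zpowers φ) r'.range bot_le hle
    rw [Nat.card_zpowers, hord] at hmul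
    have hdvd : 2 * Φ.index ∣ 9 * 2 := by
      rw [hidx, hmul]; exact (Subgroup.card_dvd_of_le hDle).trans hP18
    have hdvd9 : Φ.index ∣ 9 := by
      rw [mul_comm 9 2] at hdvd
      exact Nat.dvd_of_mul_dvd_mul_left (by norm_num) hdvd
    rw [Nat.isCoprime_iff_coprime]
    exact Nat.Coprime.coprime_dvd_left hdvd9 (by norm_num)
  · -- dichotomy: `r' τ ∈ ⟨φ⟩ = {1, φ}`
    obtain ⟨k, hk⟩ := Subgroup.mem_zpowers_iff.mp ((hΦmem τ).mp hτ)
    have hcases : r' τ = 1 ∨ r' τ = φ := by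
      rw [← hk]
      rcases Int.even_or_odd k with ⟨j, rfl⟩ | ⟨j, rfl⟩
      · left
        rw [← two_mul, zpow_mul, zpow_two, hφ2, one_zpow]
      · right
        rw [zpow_add, zpow_mul, zpow_two, hφ2, one_zpow, one_mul, zpow_one]
    rcases hcases with h1 | h1
    · left; intro x; rw [hr', h1, AlgEquiv.one_apply]
    · right; intro x; rw [hr', h1]

end Summit.BirchSwinnertonDyer.BirchSwinnertonDyer.Theorems.SylvesterTwoCMHalf

end
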